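import Mathlib
import Literature.Analysis.FluidPDE.SuitableWeak
import Literature.Analysis.FluidPDE.NSSliceTimePairing
import Literature.Analysis.FluidPDE.DivCurlAnnihilator
import Summits.NavierStokesRegularity.NavierStokesRegularity.Theorems.EulerZoomLiouvillePowerGaugeEulerLiouvilleWeakTimeTestedField
import Summits.NavierStokesRegularity.NavierStokesRegularity.Theorems.EulerZoomLiouvillePowerGaugeEulerLiouvilleBackwardTools
import Summits.NavierStokesRegularity.NavierStokesRegularity.Theorems.EulerZoomLiouvillePowerGaugeEulerLiouvilleClassIsometry
import Summits.NavierStokesRegularity.NavierStokesRegularity.Theorems.EulerZoomLiouvillePowerGaugeEulerLiouvilleClockRigidity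
import HarnessLib

/-!
# Crux `EulerZoomLiouville.PowerGaugeEulerLiouville` (stmt-NavierStokesRegularity-19832), stub `stub_nonSelfSimilarRest`:
# WRONG-PARITY MEMBERS ARE DISTRIBUTIONALLY STEADY — the time-tested velocity `∫ θ'(t) u(t,·) dt` of a `±` pair vanishes

Helper file (theorems only; `--supports stmt-NavierStokesRegularity-19832`; def-free).  Hand leafhand-ns-eulerzoomliouville-10 g3;
the NON-self-similar sequel of hands g1/g2 (`…WeakAntiEquivariantProfile`: exactly self-similar `±` pairs).

PRINCIPLE.  If `(u, p)` and `(−u, p')` are BOTH distributional Euler pairs on a past slab `(−∞, T₁) × ℝ³` (this is what an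
anti-equivariant member `u(τ, Rx) = −R u(τ, x)`, `R` a linear isometry, supplies through the `O(3)`-covariance of Seregin's class),
then subtracting the two momentum identities tested with `θ(t) η(x)`, `η` a divergence-free curl pair, kills the Lamb/transport term
and the pressure: `∫∫ θ'(t) ⟪u, η⟫ = 0`.  Hence the TIME-TESTED FIELD `w_θ(x) = ∫ θ'(t) u(t, x) dt` is weakly curl-free; it is weakly
divergence-free by incompressibility, locally integrable, and has the sub-volume growth `∫_{B_r} |w_θ|² ≤ K r^{1−2ρ}` inherited from
the `A`-gauge — so it vanishes by the tree's weak harmonic Liouville theorem (`ae_eq_zero_of_weaklyHarmonic_of_growth`, packaged for time-tested fields in the companion tools file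
`…WeakTimeTestedField`: `AntiMember.timeTested_ae_eq_zero`).  Conclusion
(`AntiMember.integral_deriv_mul_inner_eq_zero_of_antiEquivariant`): `∫∫ θ'(t) χ(x) ⟪u(t,x), e⟫ = 0` for all `θ ∈ C_c^∞((−∞,T₁))`, `χ ∈ C_c^∞(ℝ³)`, `e`
— the velocity is steady in the sense of distributions on the past slab.  (The passage «distributionally steady ⇒ a.e. steady ⇒
trivial» is the sequel file.)

WHAT THIS IS NOT: not a proof of the stub or of the crux; nothing about Navier–Stokes. [folklore; MajdaBertozziCUP2002 §1.2 Prop. 1.1]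
-/


noncomputable section

-- flat `Theorems/<Route><Decl>…` files of one crux share the namespace of the crux (tree convention)
set_option linter.dupNamespace false

open MeasureTheory Set Filter Topology Metric Function TopologicalSpace
open scoped RealInnerProductSpace NNReal ENNReal ContDiff Laplacian

namespace Summit.NavierStokesRegularity.NavierStokesRegularity.Theorems.PowerGaugeEulerLiouville

open Literature.Analysis Literature.Analysis.FunctionSpaces Literature.Analysis.FluidPDE

namespace AntiMember

variable {u : ℝ → EuclideanSpace ℝ (Fin 3) → EuclideanSpace ℝ (Fin 3)} {T : ℝ}

/-! ## 1. The momentum identity tested with a tensor `θ(t) η(x)`, `η` divergence free -/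

/-- Divergence of a constant multiple: `div (c • η) = c · div η` at points of differentiability. [folklore] -/
theorem divergence_const_smul {η : EuclideanSpace ℝ (Fin 3) → EuclideanSpace ℝ (Fin 3)} {x : EuclideanSpace ℝ (Fin 3)}
    (hη : DifferentiableAt ℝ η x) (c : ℝ) :
    VectorCalculus.divergence (fun y => c • η y) x = c * VectorCalculus.divergence η x := by
  unfold VectorCalculus.divergence
  have e : (fun y => c • η y) = c • η := rfl
  rw [e, fderiv_const_smul hη c, ContinuousLinearMap.toLinearMap_smul, map_smul, smul_eq_mul]

/-- **The distributional Euler momentum identity tested with `θ(t) η(x)`, `η` a divergence-free test field**: for a distributional Euler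
pair `(u, p)` (no force) on the slab `(−∞,T) × ℝ³` and `θ ∈ C_c^∞((−∞,T))`,
`∫∫ θ'(t) ⟪u, η⟫ + θ(t) ⟪u, Dη[u]⟫ = 0` (the pressure drops out since `div η = 0`; the integral is over `ℝ × ℝ³`, the integrand vanishing
for `t ≥ T`). [folklore; MajdaBertozziCUP2002 §1.2] -/
theorem momentum_tensor {p : ℝ → EuclideanSpace ℝ (Fin 3) → ℝ}
    (hdist : IsDistributionalNSSolutionOn (slab (EuclideanSpace ℝ (Fin 3)) (Iio T) isOpen_Iio) 0 0 u p)
    {θ : ℝ → ℝ} (hθ : ContDiff ℝ ∞ θ) (hθc : HasCompactSupport θ) (hθT : tsupport θ ⊆ Iio T)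
    {η : EuclideanSpace ℝ (Fin 3) → EuclideanSpace ℝ (Fin 3)} (hη : IsTestFunctionOn (⊤ : Opens (EuclideanSpace ℝ (Fin 3))) η)
    (hdiv : ∀ x, VectorCalculus.divergence η x = 0) :
    ∫ z : ℝ × EuclideanSpace ℝ (Fin 3), (deriv θ z.1 * ⟪u z.1 z.2, η z.2⟫ + θ z.1 * ⟪u z.1 z.2, fderiv ℝ η z.2 (u z.1 z.2)⟫) = 0 := by
  have hη' : IsTestFunctionOn (⟨univ, isOpen_univ⟩ : Opens (EuclideanSpace ℝ (Fin 3))) η :=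
    ⟨hη.contDiff, hη.hasCompactSupport, fun _ _ => trivial⟩
  have hψ : IsSpaceTimeTestOn (slab (EuclideanSpace ℝ (Fin 3)) (Iio T) isOpen_Iio) (fun t x => θ t • η x) :=
    isSpaceTimeTestOn_prod_smul isOpen_Iio isOpen_univ hθ hθc hθT hη'
  have H := hdist.2.2.2.2 _ hψ
  have hθd : Differentiable ℝ θ := hθ.differentiable (by simp)
  have hηd : Differentiable ℝ η := hη.contDiff.differentiable (by simp)
  -- the integrand, pointwise
  have hpt : ∀ z : ℝ × EuclideanSpace ℝ (Fin 3),
      ⟪u z.1 z.2, timeDeriv (fun t x => θ t • η x) z.1 z.2⟫ +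
            ⟪u z.1 z.2, convect (u z.1) (fun x => θ z.1 • η x) z.2⟫ +
          0 * ⟪u z.1 z.2, Δ (fun x => θ z.1 • η x) z.2⟫ +
        p z.1 z.2 * VectorCalculus.divergence (fun x => θ z.1 • η x) z.2 +
      ⟪(0 : ℝ → EuclideanSpace ℝ (Fin 3) → EuclideanSpace ℝ (Fin 3)) z.1 z.2, θ z.1 • η z.2⟫ =
      deriv θ z.1 * ⟪u z.1 z.2, η z.2⟫ + θ z.1 * ⟪u z.1 z.2, fderiv ℝ η z.2 (u z.1 z.2)⟫ := by
    intro z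
    rw [timeDeriv_prod_smul hθd, convect_apply]
    have h1 : fderiv ℝ (fun x => θ z.1 • η x) z.2 (u z.1 z.2) = θ z.1 • fderiv ℝ η z.2 (u z.1 z.2) := by
      have e : (fun x => θ z.1 • η x) = θ z.1 • η := rfl
      rw [e, fderiv_const_smul (hηd z.2) (θ z.1)]; rfl
    have h2 : VectorCalculus.divergence (fun x => θ z.1 • η x) z.2 = 0 := by
      rw [divergence_const_smul (hηd z.2), hdiv, mul_zero]
    rw [h1, h2, real_inner_smul_right, real_inner_smul_right]
    simp
  -- the set integral over the slab is the integral over `ℝ × ℝ³`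
  have hvan : ∀ z : ℝ × EuclideanSpace ℝ (Fin 3), z ∉ Iio T ×ˢ (univ : Set (EuclideanSpace ℝ (Fin 3))) →
      deriv θ z.1 * ⟪u z.1 z.2, η z.2⟫ + θ z.1 * ⟪u z.1 z.2, fderiv ℝ η z.2 (u z.1 z.2)⟫ = 0 := by
    intro z hz
    have ht : T ≤ z.1 := by
      by_contra h
      exact hz ⟨not_le.1 h, mem_univ _⟩
    rw [eq_zero_of_tsupport_subset_Iio hθT ht, deriv_eq_zero_of_tsupport_subset_Iio hθT ht]
    ring
  have H' : ∫ z in Iio T ×ˢ (univ : Set (EuclideanSpace ℝ (Fin 3))),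
      (deriv θ z.1 * ⟪u z.1 z.2, η z.2⟫ + θ z.1 * ⟪u z.1 z.2, fderiv ℝ η z.2 (u z.1 z.2)⟫) = 0 := by
    refine Eq.trans ?_ H
    rw [coe_slab]
    exact setIntegral_congr_fun (measurableSet_Iio.prod MeasurableSet.univ) (fun z _ => (hpt z).symm)
  rw [setIntegral_eq_integral_of_forall_compl_eq_zero hvan] at H'
  exact H'

/-- **SUBTRACTION OF A `±` PAIR.**  If `(u, p)` and `(u', p')` are distributional Euler pairs on `(−∞,T₀) × ℝ³` and `u' = −u` on the past
slab `t < T₁ ≤ T₀`, then for every `θ ∈ C_c^∞((−∞,T₁))` and every divergence-free test field `η`, `∫∫ θ'(t) ⟪u(t,x), η(x)⟫ = 0`: the two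
tested momentum identities have the same quadratic term and opposite linear terms. [folklore] -/
theorem integral_deriv_mul_inner_divFree_eq_zero {p p' : ℝ → EuclideanSpace ℝ (Fin 3) → ℝ}
    {u' : ℝ → EuclideanSpace ℝ (Fin 3) → EuclideanSpace ℝ (Fin 3)} {T₀ T₁ : ℝ} (hT : T₁ ≤ T₀)
    (hdist : IsDistributionalNSSolutionOn (slab (EuclideanSpace ℝ (Fin 3)) (Iio T₀) isOpen_Iio) 0 0 u p)
    (hdist' : IsDistributionalNSSolutionOn (slab (EuclideanSpace ℝ (Fin 3)) (Iio T₀) isOpen_Iio) 0 0 u' p')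
    (hneg : ∀ t : ℝ, t < T₁ → ∀ x, u' t x = -u t x)
    {θ : ℝ → ℝ} (hθ : ContDiff ℝ ∞ θ) (hθc : HasCompactSupport θ) (hθT : tsupport θ ⊆ Iio T₁)
    {η : EuclideanSpace ℝ (Fin 3) → EuclideanSpace ℝ (Fin 3)} (hη : IsTestFunctionOn (⊤ : Opens (EuclideanSpace ℝ (Fin 3))) η)
    (hdiv : ∀ x, VectorCalculus.divergence η x = 0) :
    ∫ z : ℝ × EuclideanSpace ℝ (Fin 3), deriv θ z.1 * ⟪u z.1 z.2, η z.2⟫ = 0 := by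
  have hθT₀ : tsupport θ ⊆ Iio T₀ := hθT.trans (Iio_subset_Iio hT)
  have H1 := momentum_tensor hdist hθ hθc hθT₀ hη hdiv
  have H2 := momentum_tensor hdist' hθ hθc hθT₀ hη hdiv
  -- rewrite the second identity in terms of `u`
  have hpt : ∀ z : ℝ × EuclideanSpace ℝ (Fin 3),
      deriv θ z.1 * ⟪u' z.1 z.2, η z.2⟫ + θ z.1 * ⟪u' z.1 z.2, fderiv ℝ η z.2 (u' z.1 z.2)⟫ =
      -(deriv θ z.1 * ⟪u z.1 z.2, η z.2⟫) + θ z.1 * ⟪u z.1 z.2, fderiv ℝ η z.2 (u z.1 z.2)⟫ := by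
    intro z
    by_cases hz : z.1 < T₁
    · rw [hneg z.1 hz z.2, map_neg, inner_neg_left, inner_neg_left, inner_neg_right, neg_neg]
      ring
    · have ht : T₁ ≤ z.1 := not_lt.1 hz
      rw [eq_zero_of_tsupport_subset_Iio hθT ht, deriv_eq_zero_of_tsupport_subset_Iio hθT ht]
      ring
  simp_rw [hpt] at H2
  -- integrability of the two summands on `ℝ × ℝ³`
  obtain ⟨hκ, hκc, hκT⟩ := deriv_cutoff_props hθ hθc hθT₀
  have hu : LocallyIntegrableOn (uncurry u) (Iio T₀ ×ˢ (univ : Set (EuclideanSpace ℝ (Fin 3)))) volume := by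
    simpa only [coe_slab] using hdist.1
  have hum : AEStronglyMeasurable (uncurry u) (volume.restrict (Iio T₀ ×ˢ (univ : Set (EuclideanSpace ℝ (Fin 3))))) :=
    hu.aestronglyMeasurable
  have hu2 : LocallyIntegrableOn (fun z => ‖uncurry u z‖ ^ 2) (Iio T₀ ×ˢ (univ : Set (EuclideanSpace ℝ (Fin 3)))) volume := by
    simpa only [coe_slab] using hdist.2.1
  have iA := integrable_mul_inner_field hu hκ hκc hκT hη.contDiff.continuous hη.hasCompactSupport
  have iB := integrable_mul_inner_fderiv_apply hum hu2 hθ.continuous hθc hθT₀ (hη.contDiff.of_le (by norm_cast))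
    hη.hasCompactSupport
  have iA' : Integrable (fun z : ℝ × EuclideanSpace ℝ (Fin 3) => -(deriv θ z.1 * ⟪u z.1 z.2, η z.2⟫))
      (volume : Measure (ℝ × EuclideanSpace ℝ (Fin 3))) := iA.neg
  rw [integral_add iA iB] at H1
  rw [integral_add iA' iB, integral_neg] at H2
  linarith

end AntiMember

/-! ## 2. MEMBER LEVEL: a `±` pair in the class is distributionally steady -/

/-- **A `±` PAIR OF CLASS MEMBERS IS DISTRIBUTIONALLY STEADY ON THE PAST SLAB.**  Let `(u, p)` be a suitable weak Euler pair on `(−∞,0) × ℝ³` with the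
`A`-gauge `a^{2ρ} A(a) ≤ c` (`ρ > −1`), and let `(u', p')` be a distributional Euler pair on the same slab with `u' = −u` for `t < T₁ ≤ 0`.  Then for every
`θ ∈ C_c^∞((−∞,T₁))` and every continuous compactly supported field `Φ`, `∫∫ θ'(t) ⟪u(t,x), Φ(x)⟫ = 0`.  (Subtraction kills the Lamb term and
the pressure; the time-tested field `∫θ' u` is weakly curl- and divergence-free with `A`-gauge growth `r^{1−2ρ}`, `1 − 2ρ < 3`, hence zero.) [folklore] -/
theorem AntiMember.integral_deriv_mul_inner_eq_zero_of_negPair {ρ : ℝ} (hρ : -1 < ρ)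
    {u u' : ℝ → EuclideanSpace ℝ (Fin 3) → EuclideanSpace ℝ (Fin 3)} {p p' : ℝ → EuclideanSpace ℝ (Fin 3) → ℝ} {c : ℝ≥0}
    (hsw : IsSuitableWeakSolutionOn (slab (EuclideanSpace ℝ (Fin 3)) (Iio 0) isOpen_Iio) 0 0 u p)
    (hA : ∀ a : ℝ, 0 < a → ENNReal.ofReal (a ^ (2 * ρ)) * cknA a (0 : ℝ × EuclideanSpace ℝ (Fin 3)) u ≤ (c : ℝ≥0∞))
    (hdist' : IsDistributionalNSSolutionOn (slab (EuclideanSpace ℝ (Fin 3)) (Iio 0) isOpen_Iio) 0 0 u' p')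
    {T₁ : ℝ} (hT₁ : T₁ ≤ 0) (hneg : ∀ t : ℝ, t < T₁ → ∀ x, u' t x = -u t x)
    {θ : ℝ → ℝ} (hθ : ContDiff ℝ ∞ θ) (hθc : HasCompactSupport θ) (hθT : tsupport θ ⊆ Iio T₁)
    {Φ : EuclideanSpace ℝ (Fin 3) → EuclideanSpace ℝ (Fin 3)} (hΦ : Continuous Φ) (hΦc : HasCompactSupport Φ) :
    ∫ z : ℝ × EuclideanSpace ℝ (Fin 3), deriv θ z.1 * ⟪u z.1 z.2, Φ z.2⟫ = 0 := by
  have hdist := hsw.distributional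
  have hθT0 : tsupport θ ⊆ Iio 0 := hθT.trans (Iio_subset_Iio hT₁)
  obtain ⟨hκ, hκc, hκT⟩ := AntiMember.deriv_cutoff_props hθ hθc hθT0
  have hκT₁ : tsupport (deriv θ) ⊆ Iio T₁ := tsupport_deriv_subset.trans hθT
  have hu : LocallyIntegrableOn (uncurry u) (Iio 0 ×ˢ (univ : Set (EuclideanSpace ℝ (Fin 3)))) volume := by
    simpa only [coe_slab] using hdist.1
  -- (i) incompressibility, time-tested
  have hdiv : ∀ g : EuclideanSpace ℝ (Fin 3) → ℝ, IsTestFunctionOn (⊤ : Opens (EuclideanSpace ℝ (Fin 3))) g →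
      ∫ z : ℝ × EuclideanSpace ℝ (Fin 3), deriv θ z.1 * ⟪u z.1 z.2, gradient g z.2⟫ = 0 := by
    intro g hg
    have hg' : IsTestFunctionOn (⟨univ, isOpen_univ⟩ : Opens (EuclideanSpace ℝ (Fin 3))) g :=
      ⟨hg.contDiff, hg.hasCompactSupport, fun _ _ => trivial⟩
    have hΘ : IsSpaceTimeTestOn (slab (EuclideanSpace ℝ (Fin 3)) (Iio 0) isOpen_Iio) (fun t x => deriv θ t • g x) :=
      isSpaceTimeTestOn_prod_smul isOpen_Iio isOpen_univ (hθ.deriv') hκc hκT hg'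
    have H := hdist.2.2.2.1 _ hΘ
    have hgd : Differentiable ℝ g := hg.contDiff.differentiable (by simp)
    have hpt : ∀ z : ℝ × EuclideanSpace ℝ (Fin 3),
        ⟪u z.1 z.2, gradient (fun x => deriv θ z.1 • g x) z.2⟫ = deriv θ z.1 * ⟪u z.1 z.2, gradient g z.2⟫ := by
      intro z
      have e : (fun x => deriv θ z.1 • g x) = fun x => deriv θ z.1 * g x := rfl
      rw [e, ClockRigidity.gradient_const_mul' (hgd z.2), real_inner_smul_right]
    have hvan : ∀ z : ℝ × EuclideanSpace ℝ (Fin 3), z ∉ Iio (0 : ℝ) ×ˢ (univ : Set (EuclideanSpace ℝ (Fin 3))) →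
        deriv θ z.1 * ⟪u z.1 z.2, gradient g z.2⟫ = 0 := by
      intro z hz
      have ht : (0 : ℝ) ≤ z.1 := by
        by_contra h
        exact hz ⟨not_le.1 h, mem_univ _⟩
      rw [AntiMember.deriv_eq_zero_of_tsupport_subset_Iio hθT0 ht, zero_mul]
    have H' : ∫ z in Iio (0 : ℝ) ×ˢ (univ : Set (EuclideanSpace ℝ (Fin 3))), deriv θ z.1 * ⟪u z.1 z.2, gradient g z.2⟫ = 0 := by
      refine Eq.trans ?_ H
      rw [coe_slab]
      exact setIntegral_congr_fun (measurableSet_Iio.prod MeasurableSet.univ) (fun z _ => (hpt z).symm)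
    rwa [setIntegral_eq_integral_of_forall_compl_eq_zero hvan] at H'
  -- (ii) weak curl-freeness of the time-tested field, from the `±` pair
  have hcurl : ∀ g : EuclideanSpace ℝ (Fin 3) → ℝ, IsTestFunctionOn (⊤ : Opens (EuclideanSpace ℝ (Fin 3))) g →
      ∀ a c : EuclideanSpace ℝ (Fin 3),
        ∫ z : ℝ × EuclideanSpace ℝ (Fin 3), deriv θ z.1 * ⟪u z.1 z.2, fderiv ℝ g z.2 a • c - fderiv ℝ g z.2 c • a⟫ = 0 := by
    intro g hg a c'
    exact AntiMember.integral_deriv_mul_inner_divFree_eq_zero hT₁ hdist hdist' hneg hθ hθc hθT (isTestFunctionOn_curlPair hg a c')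
      (isDivFree_curlPair_of_contDiff (hg.contDiff.of_le (by norm_cast)) a c')
  -- (iii) growth from the `A`-gauge
  obtain ⟨M, hM⟩ := hκ.bounded_above_of_compact_support hκc
  obtain ⟨a₀, ha₀⟩ := hκc.isCompact.bddBelow
  set a : ℝ := min (a₀ - 1) (T₁ - 1) with hadef
  have hab : a < T₁ := lt_of_le_of_lt (min_le_right _ _) (by linarith)
  have hκS : ∀ t ∉ Ioo a T₁, deriv θ t = 0 := by
    intro t ht
    by_contra hne
    have hts : t ∈ tsupport (deriv θ) := subset_tsupport _ hne
    exact ht ⟨lt_of_le_of_lt (min_le_left _ _) (by linarith [ha₀ hts]), hκT₁ hts⟩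
  have hum : AEStronglyMeasurable (uncurry u) (volume.restrict (Iio (0 : ℝ) ×ˢ (univ : Set (EuclideanSpace ℝ (Fin 3))))) :=
    hu.aestronglyMeasurable
  set r₀ : ℝ := |a| + 1 with hr₀def
  have hgrowth : ∀ r : ℝ, r₀ < r → 0 < r →
      ∫⁻ x in ball (0 : EuclideanSpace ℝ (Fin 3)) r, ‖∫ t, deriv θ t • u t x‖ₑ ^ 2 ≤
        ENNReal.ofReal (M ^ 2 * (T₁ - a) * ((T₁ - a) * c) * r ^ (1 - 2 * ρ)) := by
    intro r hr hr0
    have hr1 : 1 < r := by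
      have : (0 : ℝ) ≤ |a| := abs_nonneg a
      linarith
    have hra : -(r ^ 2) < a := by
      have h1 : |a| < r := by linarith [abs_nonneg a]
      have h2 : r < r ^ 2 := by nlinarith
      have h3 : -|a| ≤ a := neg_abs_le a
      linarith
    have hB : ∀ t ∈ Ioo a T₁, ∫⁻ x in ball (0 : EuclideanSpace ℝ (Fin 3)) r, ‖u t x‖ₑ ^ 2 ≤
        ENNReal.ofReal ((c : ℝ) * r ^ (1 - 2 * ρ)) := fun t ht =>
      Backward.lintegral_ball_le_of_gaugeA hr0 (hA r hr0) ⟨by linarith [ht.1], lt_of_lt_of_le ht.2 hT₁⟩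
    have h1 := AntiMember.lintegral_ball_timeTested_le hum hT₁ hκS hM hB
    refine h1.trans (le_of_eq ?_)
    have hM0 : 0 ≤ M := (norm_nonneg _).trans (hM 0)
    have hTa : 0 ≤ T₁ - a := by linarith
    rw [← ENNReal.ofReal_mul (sq_nonneg M), ← ENNReal.ofReal_mul hTa, ← ENNReal.ofReal_mul (mul_nonneg (sq_nonneg M) hTa)]
    congr 1
    ring
  have hm : 1 - 2 * ρ < 3 := by linarith
  have hw0 := AntiMember.timeTested_ae_eq_zero hu hκ hκc hκT hdiv hcurl hm hgrowth
  rw [← AntiMember.integral_inner_timeTested hu hκ hκc hκT hΦ hΦc]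
  have : (fun x => ⟪(∫ t, deriv θ t • u t x), Φ x⟫) =ᵐ[volume] fun _ => (0 : ℝ) := by
    filter_upwards [hw0] with x hx
    rw [hx]; simp
  rw [integral_congr_ae this, integral_zero]

/-- **AN ANTI-EQUIVARIANT CLASS MEMBER IS DISTRIBUTIONALLY STEADY ON ITS PAST SLAB.**  Let `(u, p)` be a suitable weak Euler pair on `(−∞,0) × ℝ³`
with the `A`-gauge `a^{2ρ} A(a) ≤ c` (`ρ > −1`), and suppose `u(τ, Rx) = −R u(τ, x)` for all `τ < T₁ ≤ 0`, all `x`, for some linear isometry `R`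
of `ℝ³` (`R = −1`: `u(τ,·)` EVEN; `R` a reflection / half-turn: the wrong-parity mirror / axial symmetries).  Then `∫∫ θ'(t) ⟪u(t,x), Φ(x)⟫ = 0` for
every `θ ∈ C_c^∞((−∞,T₁))` and every continuous compactly supported `Φ`: the conjugated pair `(R u(τ,R⁻¹·), p(τ,R⁻¹·))` is again a distributional
Euler pair (`ClassIsometry.isSuitableWeakSolutionOn_conj_isometry`) and equals `−u` on the past slab. [folklore; MajdaBertozziCUP2002 §1.2 Prop. 1.1] -/
theorem AntiMember.integral_deriv_mul_inner_eq_zero_of_antiEquivariant {ρ : ℝ} (hρ : -1 < ρ)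
    {u : ℝ → EuclideanSpace ℝ (Fin 3) → EuclideanSpace ℝ (Fin 3)} {p : ℝ → EuclideanSpace ℝ (Fin 3) → ℝ} {c : ℝ≥0}
    (hsw : IsSuitableWeakSolutionOn (slab (EuclideanSpace ℝ (Fin 3)) (Iio 0) isOpen_Iio) 0 0 u p)
    (hA : ∀ a : ℝ, 0 < a → ENNReal.ofReal (a ^ (2 * ρ)) * cknA a (0 : ℝ × EuclideanSpace ℝ (Fin 3)) u ≤ (c : ℝ≥0∞))
    (R : EuclideanSpace ℝ (Fin 3) ≃ₗᵢ[ℝ] EuclideanSpace ℝ (Fin 3)) {T₁ : ℝ} (hT₁ : T₁ ≤ 0)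
    (hanti : ∀ τ : ℝ, τ < T₁ → ∀ x : EuclideanSpace ℝ (Fin 3), u τ (R x) = -(R (u τ x)))
    {θ : ℝ → ℝ} (hθ : ContDiff ℝ ∞ θ) (hθc : HasCompactSupport θ) (hθT : tsupport θ ⊆ Iio T₁)
    {Φ : EuclideanSpace ℝ (Fin 3) → EuclideanSpace ℝ (Fin 3)} (hΦ : Continuous Φ) (hΦc : HasCompactSupport Φ) :
    ∫ z : ℝ × EuclideanSpace ℝ (Fin 3), deriv θ z.1 * ⟪u z.1 z.2, Φ z.2⟫ = 0 := by
  have hsw' := ClassIsometry.isSuitableWeakSolutionOn_conj_isometry isOpen_Iio hsw R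
  have hf0 : (fun (s : ℝ) (x : EuclideanSpace ℝ (Fin 3)) =>
      R ((0 : ℝ → EuclideanSpace ℝ (Fin 3) → EuclideanSpace ℝ (Fin 3)) s (R.symm x))) = 0 := by
    funext s x
    simp
  rw [hf0] at hsw'
  refine AntiMember.integral_deriv_mul_inner_eq_zero_of_negPair hρ hsw hA hsw'.distributional hT₁ ?_ hθ hθc hθT hΦ hΦc
  intro t ht x
  have h1 := hanti t ht (R.symm x)
  rw [LinearIsometryEquiv.apply_symm_apply] at h1
  show R (u t (R.symm x)) = -u t x
  rw [h1, neg_neg]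

end Summit.NavierStokesRegularity.NavierStokesRegularity.Theorems.PowerGaugeEulerLiouville

end
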